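import Literature.NumberTheory.EllipticCurves.ZpExtensionEisensteinResidualKernelProofs
import Literature.NumberTheory.EllipticCurves.ZpExtensionEisensteinOrdinaryFilTransferProofs
import Literature.NumberTheory.EllipticCurves.TowerPresentedSubquotientCohomologyProofs
import Literature.NumberTheory.EllipticCurves.TowerSaturatedKernelCoresProofs
import Literature.NumberTheory.EllipticCurves.ZpExtensionEisensteinGradedInvariantsVanishingProofs
import HarnessLib

/-!
# The residual image of Howard's `F_𝔮` at a place above `p` is the residual STRICT ordinary condition
# (non-anomalous readout; theorems only — no definition, no named fact, no instance, no `sorry`)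

Topic `NumberTheory/EllipticCurves` (D1 road of cell `pub/bsd-print-x9`; the (↓)+(↑) readout of seat `bsd-line-x10b-p1-w8` g2's
(H5B-P), memo `HOME/x9-p1-w3/H5B-AT-P-PLAN-w3g5.md` (H-a); assembler ruling LEAD g8 2026-08-28T20:16:54Z (R1)).

For the Eisenstein tower `W_j = M_j ⊗ A_{m,j}(ψ)` (x9-p1-w3's two-index family `ZpExtension.eisensteinTwistTransfer`) with an
ordinary datum `Φ` at a finite place `w ∋ p` (`Fil_w W_j = A_{m,j} ⊗ Fil_w M_j`, `OrdinaryFiltration.twistedFil`), Howard's condition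
`F_𝔮(w)` at level `1` is the level condition of the SATURATED tower of STRICT ordinary cores
`ker (H¹(K_w, W_j) → H¹(K_w, W_j / Fil_w W_j))` (`ZpExtension.eisensteinSelmerStructure_inr_of_mem`) [B. Howard, Compositio Math.
140 (2004), Def. 3.1.2, arXiv:1202.6340 p. 15 L99–108: `H¹_ord = im H¹(K_v, Fil_v V_𝔮)` «propagated to `T_𝔮`»].  Given a residual
presentation `π̄ : W₁ ↠ T̄` by the maximal ideal `([T])` of `A_{m,1}` (`Howard2004.IsQuotientBy`) and a `Γ_{K_w}`-stable `Fil_w T̄ ≤ T̄`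
onto which `π̄` maps `Fil_w W₁` on `H¹`, the condition PROPAGATED TO `T̄` is

  **`F̄_𝔮(w) = π̄_* F_𝔮(w) = ker (H¹(K_w, T̄) → H¹(K_w, T̄ / Fil_w T̄))`**  (`propagate_eisensteinSelmerStructure_one_eq_strictSubgroup`),

for EVERY `m ≥ 1` and every character of the tower, under the two NON-ANOMALOUS inputs at `w` — (H0₁) the quotient `W₁ / Fil_w W₁`
has no non-zero `Γ_{K_w}`-invariants (x10b-p1-w8's `ZpExtensionEisensteinGradedInvariantsVanishingProofs`: from «`σ₀` acts on `gr_w M₁`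
by `n₀ ≢ 1`») and (H2₁) `H²(K_w, Fil_w W₁) = 0` (x10b-p1-w8's `ZpExtensionEisensteinTwistedFilH2VanishingProofs`: from
«`Hom_{Γ_w}(Fil_w M₁, μ_p) = 0`») — and the structural inputs of x10b-p1-w6's presented sub/quotient towers
(`TowerPresentedSubquotientProofs`: the transitions are onto on `Fil_w M_k` (⇒ (map), x9-p1-w3's `ZpExtensionEisensteinOrdinaryFilTransferProofs`),
(ONTO), (SAT)).  Assembly: the generic `Tower.map_levelCondition_one_eq_ker` (`TowerSaturatedKernelCoresProofs`) on the three
presented towers `Fil ↪ W ↠ W/Fil` at `w`, with `hH0` from `Tower.eq_zero_of_mem_invariants_of_level_one`, LIFT from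
`Tower.map_subFamily_surjective_of_subsingleton`; the residual row `0 → Fil_w T̄ → T̄ → T̄/Fil_w T̄ → 0` (`isSES_subtype_mkQ`).

For `M_k = E[p^k]`, `T̄ = E[p]`, `Fil_w T̄ = E[p] ∩ E₁(K̄_w)` this is the input of H.5(b) at `w ∣ p` («`τ` takes the local condition at
`v̄` to the one at `v`»: transport `TorsionFilAtStrictTransportProofs`).  No summit statement is proved; BSD is not proved by any of this.

References: [Howard2004HeegnerKolyvagin] Def. 1.1.1/1.1.3, §1.3 H.5(b), Def. 3.1.2, §3.1, Lemma 3.2.7 (arXiv:1202.6340 p. 5, p. 7 L96–97,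
p. 15 L56–66 and L99–108, p. 16 L150–160); [MazurRubinMemoirs2004] Def. 1.1.1, Example 1.1.2; [GreenbergLNM1716] §2;
[SerreGaloisCohomology1997] I §2.2.
-/

set_option autoImplicit false

noncomputable section

open scoped TensorProduct ContRepresentation
open Function Field IsDedekindDomain

namespace Literature.NumberTheory.EllipticCurves

namespace ZpExtension

open Literature.NumberTheory.GaloisRepresentations IwasawaAlgebra
open Literature.NumberTheory.GaloisCohomology.Howard2004
open scoped NumberField

variable {K : Type} [Field K] [NumberField K] {p : ℕ} [hp : Fact p.Prime] (κ : ZpExtension K p)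
  {M : ℕ → Type} [∀ k, AddCommGroup (M k)] [∀ k, TopologicalSpace (M k)] [∀ k, DiscreteTopology (M k)]
  (ρ : ∀ k, DiscreteGaloisModule K (M k))
  (t : ∀ k, (ρ (k + 1)).toContRepresentation →ⁱL (ρ k).toContRepresentation) {m : ℕ} (hm : 1 ≤ m)

/-- **The residual image of `F_𝔮` at `w ∋ p` is the residual STRICT ordinary condition** (non-anomalous readout).  Generic
Eisenstein tower (`ht/hkt/hkill`, coordinates `e`, levels `M_j` finite), ordinary data `Φ v` at the places above `p`, a place
`w ∋ p` with: the transitions onto on `Fil_w M_k` (`hFsurj`), (ONTO)/(SAT) for `Fil_w W_j = A_{m,j} ⊗ Fil_w M_j` in the tower at `w`,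
no `Γ_{K_w}`-invariants in `W₁ / Fil_w W₁` (`hinv1`), `H²(K_w, Fil_w W₁) = 0` (`h2`); a residual presentation `π̄ : W₁ ↠ T̄` by
`([T])`, a `Γ_{K_w}`-stable `Fil_w T̄ ≤ T̄` with `π̄ (Fil_w W₁) ⊆ Fil_w T̄` (`hπFil`) and `H¹(K_w, Fil_w W₁) → H¹(K_w, Fil_w T̄)` onto
(`hliftbar`).  Then `(F_𝔮 propagated to T̄)(w) = ker (H¹(K_w, T̄) → H¹(K_w, T̄ / Fil_w T̄))`.
[cite: Howard2004HeegnerKolyvagin, Def. 3.1.2, §3.1 and Lemma 3.2.7 (arXiv:1202.6340 p. 15 L56–66 and L99–108, p. 16 L150–160)]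
[cite: MazurRubinMemoirs2004, Def. 1.1.1 and Example 1.1.2] [cite: GreenbergLNM1716, §2] -/
theorem propagate_eisensteinSelmerStructure_one_eq_strictSubgroup (ht : ∀ k, Function.Surjective (t k))
    (hkt : ∀ k (x : M (k + 1)), t k x = 0 ↔ ∃ y : M (k + 1), x = ((p : ℤ) ^ k) • y)
    (hkill : ∀ k (x : M k), ((p : ℤ) ^ k) • x = 0) {ι : ℕ → Type} [∀ k, Fintype (ι k)]
    (e : ∀ k, M k ≃+ (ι k → ZMod (p ^ k))) [∀ k, Finite (M k)]
    (S : Finset (HeightOneSpectrum (𝓞 K)))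
    (Φ : ∀ v : HeightOneSpectrum (𝓞 K), ((p : ℕ) : 𝓞 K) ∈ v.asIdeal → OrdinaryFiltration ρ t v)
    (w : HeightOneSpectrum (𝓞 K)) (hw : ((p : ℕ) : 𝓞 K) ∈ w.asIdeal)
    (hFsurj : ∀ (k : ℕ) (y : M k), y ∈ (Φ w hw).fil k → ∃ y' ∈ (Φ w hw).fil (k + 1), t k y' = y)
    (honto : ∀ ℓ n, ∀ x' ∈ (Φ w hw).twistedFil (p := p) (m := m) n,
      ∃ x ∈ (Φ w hw).twistedFil (p := p) (m := m) (ℓ + n), κ.eisensteinTwistTransfer ρ t hm ht hkt hkill (ℓ + n) n x = x')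
    (hsat : ∀ ℓ n (x : EisensteinCoeff.Twisted p m ℓ (M ℓ)),
      κ.eisensteinTwistTransfer ρ t hm ht hkt hkill ℓ (ℓ + n) x ∈ (Φ w hw).twistedFil (p := p) (m := m) (ℓ + n) →
        x ∈ (Φ w hw).twistedFil (p := p) (m := m) ℓ)
    (hinv1 : ∀ v : EisensteinCoeff.Twisted p m 1 (M 1) ⧸ (Φ w hw).twistedFil (p := p) (m := m) 1,
      (∀ σ : absoluteGaloisGroup (w.adicCompletion K),
        (GaloisRep.toLocal w (κ.eisensteinTwist (ρ 1) hm 1)).quotient ((Φ w hw).twistedFil 1)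
          ((Φ w hw).twistedFil_le_comap hm 1) σ v = v) → v = 0)
    (h2 : Subsingleton (continuousCohomology 2
      ((GaloisRep.toLocal w (κ.eisensteinTwist (ρ 1) hm 1)).subrepresentation ((Φ w hw).twistedFil 1)
        ((Φ w hw).twistedFil_le_comap hm 1)).toTopRep))
    {N : Type} [AddCommGroup N] [TopologicalSpace N] [DiscreteTopology N] [Module (EisensteinCoeff p m 1) N]
    (ρN : DiscreteGaloisModule K N) (πbar : EisensteinCoeff.Twisted p m 1 (M 1) →ₗ[EisensteinCoeff p m 1] N)
    (hbar : IsQuotientBy (κ.eisensteinTwist (ρ 1) hm 1)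
      (@IsLocalRing.maximalIdeal _ _ (EisensteinCoeff.isLocalRing_eisensteinCoeff p hm (le_refl 1))) ρN πbar)
    (FilN : Submodule ℤ N)
    (hΓN : ∀ σ : absoluteGaloisGroup (w.adicCompletion K), FilN ≤ FilN.comap (GaloisRep.toLocal w ρN σ))
    (hπFil : ∀ x ∈ (Φ w hw).twistedFil (p := p) (m := m) 1, πbar x ∈ FilN)
    (hliftbar : Function.Surjective
      (ContinuousRep.cohomologyMap
        ((GaloisRep.toLocal w (κ.eisensteinTwist (ρ 1) hm 1)).subrepresentation ((Φ w hw).twistedFil 1)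
          ((Φ w hw).twistedFil_le_comap hm 1))
        ((GaloisRep.toLocal w ρN).subrepresentation FilN hΓN)
        (πbar.toAddMonoidHom.toIntLinearMap.restrict (p := (Φ w hw).twistedFil (p := p) (m := m) 1) (q := FilN)
          hπFil).toAddMonoidHom
        continuous_of_discreteTopology
        (fun σ x ↦ Subtype.ext (hbar.equivariant (absGaloisRestrict K (w.adicCompletion K) σ)
          (x : EisensteinCoeff.Twisted p m 1 (M 1)))) 1)) :
    hbar.propagateStructure (κ.eisensteinSelmerStructure ρ t hm S Φ 1) (Sum.inr w) =
      DiscreteGaloisModule.strictSubgroup (GaloisRep.toLocal w ρN) FilN hΓN := by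
  -- ### the two-index presentation of the local tower at `w` (as in `ZpExtensionEisensteinResidualKernelProofs`)
  let Fam : ∀ a b, (κ.eisensteinTwist (ρ a) hm a).toContRepresentation →ⁱL (κ.eisensteinTwist (ρ b) hm b).toContRepresentation :=
    fun a b ↦ κ.eisensteinTwistTransfer ρ t hm ht hkt hkill a b
  let ρloc : ∀ j, DiscreteGaloisModule (w.adicCompletion K) (EisensteinLevel p m M j) :=
    fun j ↦ ((κ.eisensteinTwist (ρ j) hm j : DiscreteGaloisModule K (EisensteinLevel p m M j))).toLocal (Sum.inr w)
  let floc : ∀ a b, (ρloc a).toContRepresentation →ⁱL (ρloc b).toContRepresentation :=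
    fun a b ↦ DiscreteGaloisModule.localMap (Fam a b) (Sum.inr w)
  have hid : ∀ a (x : EisensteinLevel p m M a), floc a a x = x := fun a x ↦ κ.eisensteinTwistTransfer_self ρ t hm ht hkt hkill a x
  have hcomp : ∀ a b c', c' ≤ b → b ≤ a → ∀ x : EisensteinLevel p m M a, floc b c' (floc a b x) = floc a c' x :=
    fun a b c' hcb hba x ↦ κ.eisensteinTwistTransfer_comp ρ t hm ht hkt hkill hcb hba x
  have hinj : ∀ ℓ n, Function.Injective (floc ℓ (ℓ + n)) :=
    fun ℓ n ↦ κ.eisensteinTwistTransfer_injective_of_le ρ t hm ht hkt hkill e ℓ n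
  have hsurj : ∀ ℓ n, Function.Surjective (floc (ℓ + n) n) :=
    fun ℓ n ↦ κ.eisensteinTwistTransfer_surjective_of_le ρ t hm ht hkt hkill (Nat.le_add_left n ℓ)
  have hex : ∀ ℓ n (y : EisensteinLevel p m M (ℓ + n)), floc (ℓ + n) n y = 0 ↔ ∃ x, floc ℓ (ℓ + n) x = y :=
    fun ℓ n y ↦ κ.eisensteinTwistTransfer_eq_zero_iff_exists ρ t hm ht hkt hkill ℓ n y
  have hpow : ∀ ℓ n (x : EisensteinLevel p m M (ℓ + n)), floc ℓ (ℓ + n) (floc (ℓ + n) ℓ x) = p ^ n • x :=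
    fun ℓ n x ↦ κ.eisensteinTwistTransfer_apply_apply_of_le ρ t hm ht hkt hkill ℓ n x
  have hred : κ.eisensteinLocalReduce ρ t hm (Sum.inr w) = fun j ↦ galoisCohomology.map (floc (j + 1) j) 1 := by
    funext j
    change _ = galoisCohomology.map (DiscreteGaloisModule.localMap (κ.eisensteinTwistTransfer ρ t hm ht hkt hkill (j + 1) j) (Sum.inr w)) 1
    rw [κ.eisensteinTwistTransfer_succ_self ρ t hm ht hkt hkill j]
    rfl
  -- ### the sub/quotient towers of `Fil_w W_j`
  let Fil : ∀ j, Submodule ℤ (EisensteinLevel p m M j) := fun j ↦ (Φ w hw).twistedFil (p := p) (m := m) j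
  have hΓ : ∀ j (σ : absoluteGaloisGroup (w.adicCompletion K)), Fil j ≤ (Fil j).comap (ρloc j σ) :=
    fun j σ ↦ (Φ w hw).twistedFil_le_comap hm j σ
  have hmapF : ∀ a b, ∀ x ∈ Fil a, floc a b x ∈ Fil b :=
    fun a b x hx ↦ κ.eisensteinTwistTransfer_mem_twistedFil ρ t hm ht hkt hkill (Φ w hw) hFsurj a b x hx
  have hontoF : ∀ ℓ n, ∀ x' ∈ Fil n, ∃ x ∈ Fil (ℓ + n), floc (ℓ + n) n x = x' := fun ℓ n x' hx' ↦ honto ℓ n x' hx'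
  have hsatF : ∀ ℓ n (x : EisensteinLevel p m M ℓ), floc ℓ (ℓ + n) x ∈ Fil (ℓ + n) → x ∈ Fil ℓ :=
    fun ℓ n x hx ↦ hsat ℓ n x hx
  obtain ⟨g, hg⟩ := Tower.exists_subFamily_apply_eq ρloc floc Fil hΓ hmapF
  obtain ⟨q, hq⟩ := Tower.exists_quotFamily_apply_mk ρloc floc Fil hΓ hmapF
  -- the quotient maps and inclusions as intertwining maps
  let qI : ∀ j, (ρloc j).toContRepresentation →ⁱL ((ρloc j).quotient (Fil j) (hΓ j)).toContRepresentation := fun j ↦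
    { toContinuousLinearMap := ⟨(Fil j).mkQ, continuous_of_discreteTopology⟩
      isIntertwining' := fun σ ↦ ContinuousLinearMap.ext fun x ↦ rfl }
  let sI : ∀ j, ((ρloc j).subrepresentation (Fil j) (hΓ j)).toContRepresentation →ⁱL (ρloc j).toContRepresentation := fun j ↦
    { toContinuousLinearMap := ⟨(Fil j).subtype, continuous_subtype_val⟩
      isIntertwining' := fun σ ↦ ContinuousLinearMap.ext fun x ↦ rfl }
  have hqI : ∀ j, (ρloc j).quotientMap (Fil j) (hΓ j) 1 = galoisCohomology.map (qI j) 1 := fun j ↦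
    cohomologyMap_one_eq_map (ρloc j) ((ρloc j).quotient (Fil j) (hΓ j)) (Fil j).mkQ.toAddMonoidHom
      continuous_of_discreteTopology (fun _ _ ↦ rfl) (qI j) fun _ ↦ rfl
  have hsI : ∀ j (y : galoisCohomology ((ρloc j).subrepresentation (Fil j) (hΓ j)) 1),
      cohomologyMap (subtypeHom (ρloc j) (Fil j) (hΓ j)) 1 y = galoisCohomology.map (sI j) 1 y := fun j y ↦ rfl
  -- ### hypotheses of the generic readout
  have hidG := Tower.quotFamily_id hq hid
  have hcompG := Tower.quotFamily_comp hq hcomp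
  have hinjG := Tower.quotFamily_injective hq hsatF
  have hsurjG := Tower.quotFamily_surjective hq hsurj
  have hexG := Tower.quotFamily_exact hq hmapF hex hontoF
  have hpowG := Tower.quotFamily_pow hq p hpow
  have h0 : ∀ x : EisensteinLevel p m M 0 ⧸ Fil 0, x ∈ ((ρloc 0).quotient (Fil 0) (hΓ 0)).toTopRep.ρ.invariants → x = 0 := by
    intro x _
    induction x using Submodule.Quotient.induction_on with
    | _ u =>
      have hu : u = 0 := by
        change EisensteinCoeff.Twisted p m 0 (M 0) at u
        have h : (1 : ℕ) • u = 0 := EisensteinCoeff.prime_pow_nsmul_twisted (p := p) (m := m) (k := 0) u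
        rwa [one_smul] at h
      rw [hu, Submodule.Quotient.mk_zero]
  have h1 : ∀ x : EisensteinLevel p m M 1 ⧸ Fil 1, x ∈ ((ρloc 1).quotient (Fil 1) (hΓ 1)).toTopRep.ρ.invariants → x = 0 :=
    fun x hx ↦ hinv1 x fun σ ↦ hx σ
  have hH0 : ∀ a (x : EisensteinLevel p m M a ⧸ Fil a), x ∈ ((ρloc a).quotient (Fil a) (hΓ a)).toTopRep.ρ.invariants → x = 0 :=
    Tower.eq_zero_of_mem_invariants_of_level_one (fun j ↦ (ρloc j).quotient (Fil j) (hΓ j)) q hinjG hexG h0 h1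
  have hqf : ∀ j (x : EisensteinLevel p m M (j + 1)), qI j (floc (j + 1) j x) = q (j + 1) j (qI (j + 1) x) :=
    fun j x ↦ (hq (j + 1) j x).symm
  have hi : ∀ j (y : Fil (j + 1)), sI j (g (j + 1) j y) = floc (j + 1) j (sI (j + 1) y) := fun j y ↦ hg (j + 1) j y
  have hqi : ∀ j (y : Fil j), qI j (sI j y) = 0 := fun j y ↦ (Submodule.Quotient.mk_eq_zero _).mpr y.2
  -- the residual row
  let ρT : DiscreteGaloisModule (w.adicCompletion K) N := ρN.toLocal (Sum.inr w)
  let ibar : ((GaloisRep.toLocal w ρN).subrepresentation FilN hΓN).toContRepresentation →ⁱL ρT.toContRepresentation :=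
    { toContinuousLinearMap := ⟨FilN.subtype, continuous_subtype_val⟩
      isIntertwining' := fun σ ↦ ContinuousLinearMap.ext fun x ↦ rfl }
  let qbar : ρT.toContRepresentation →ⁱL ((GaloisRep.toLocal w ρN).quotient FilN hΓN).toContRepresentation :=
    { toContinuousLinearMap := ⟨FilN.mkQ, continuous_of_discreteTopology⟩
      isIntertwining' := fun σ ↦ ContinuousLinearMap.ext fun x ↦ rfl }
  have hqbar : DiscreteGaloisModule.quotientMap (GaloisRep.toLocal w ρN) FilN hΓN 1 = galoisCohomology.map qbar 1 :=
    cohomologyMap_one_eq_map ρT ((GaloisRep.toLocal w ρN).quotient FilN hΓN) FilN.mkQ.toAddMonoidHom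
      continuous_of_discreteTopology (fun _ _ ↦ rfl) qbar fun _ ↦ rfl
  have hibar : ∀ y, cohomologyMap (subtypeHom (GaloisRep.toLocal w ρN) FilN hΓN) 1 y = galoisCohomology.map ibar 1 y :=
    fun y ↦ rfl
  let πW : (ρloc 1).toContRepresentation →ⁱL ρT.toContRepresentation :=
    { toContinuousLinearMap := ⟨πbar.toAddMonoidHom.toIntLinearMap, continuous_of_discreteTopology⟩
      isIntertwining' := fun σ ↦ ContinuousLinearMap.ext fun x ↦ hbar.equivariant _ x }
  have hπW : hbar.localCohomologyMap (Sum.inr w) 1 = galoisCohomology.map πW 1 :=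
    cohomologyMap_one_eq_map (ρloc 1) ρT πbar.toAddMonoidHom continuous_of_discreteTopology
      (fun _ x ↦ hbar.equivariant _ x) πW fun _ ↦ rfl
  let πP : ((ρloc 1).subrepresentation (Fil 1) (hΓ 1)).toContRepresentation →ⁱL
      ((GaloisRep.toLocal w ρN).subrepresentation FilN hΓN).toContRepresentation :=
    { toContinuousLinearMap :=
        ⟨(πbar.toAddMonoidHom.toIntLinearMap.restrict fun x hx ↦ hπFil x hx), continuous_of_discreteTopology⟩
      isIntertwining' := fun σ ↦ ContinuousLinearMap.ext fun x ↦ Subtype.ext (hbar.equivariant _ (x : EisensteinLevel p m M 1)) }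
  have hleQ : Fil 1 ≤ FilN.comap πbar.toAddMonoidHom.toIntLinearMap := fun x hx ↦ hπFil x hx
  let πG : ((ρloc 1).quotient (Fil 1) (hΓ 1)).toContRepresentation →ⁱL
      ((GaloisRep.toLocal w ρN).quotient FilN hΓN).toContRepresentation :=
    { toContinuousLinearMap := ⟨(Fil 1).mapQ FilN πbar.toAddMonoidHom.toIntLinearMap hleQ, continuous_of_discreteTopology⟩
      isIntertwining' := fun σ ↦ by
        refine ContinuousLinearMap.ext fun x ↦ ?_
        induction x using Submodule.Quotient.induction_on with
        | _ u =>
          change (Fil 1).mapQ FilN _ hleQ (((ρloc 1).quotient (Fil 1) (hΓ 1)) σ (Submodule.Quotient.mk u)) =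
            ((GaloisRep.toLocal w ρN).quotient FilN hΓN) σ ((Fil 1).mapQ FilN _ hleQ (Submodule.Quotient.mk u))
          rw [ContinuousRep.quotient_apply_mk, Submodule.mapQ_apply, Submodule.mapQ_apply, ContinuousRep.quotient_apply_mk]
          exact congrArg _ (hbar.equivariant _ u) }
  have hπi : ∀ y : Fil 1, πW (sI 1 y) = ibar (πP y) := fun _ ↦ rfl
  have hπq : ∀ x : EisensteinLevel p m M 1, qbar (πW x) = πG (qI 1 x) := fun _ ↦ rfl
  have hexbar : ∀ ybar : galoisCohomology ρT 1, galoisCohomology.map qbar 1 ybar = 0 →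
      ∃ y, galoisCohomology.map ibar 1 y = ybar := by
    intro ybar hy
    rw [← hqbar] at hy
    obtain ⟨y, hyy⟩ := (isSES_subtype_mkQ (GaloisRep.toLocal w ρN) FilN hΓN).exists_map_one_eq_of_map_one_eq_zero ybar hy
    exact ⟨y, hyy⟩
  have hliftP : ∀ j, Function.Surjective (galoisCohomology.map (g (j + 1 + 1) (j + 1)) 1) := by
    intro j
    have hS := Tower.map_subFamily_surjective_of_subsingleton hg hinj hex hontoF hsatF 1 (j + 1) h2
    rw [Nat.add_comm 1 (j + 1)] at hS
    exact hS
  have hliftbar' : Function.Surjective (galoisCohomology.map πP 1) := by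
    have heq : ContinuousRep.cohomologyMap ((ρloc 1).subrepresentation (Fil 1) (hΓ 1))
        ((GaloisRep.toLocal w ρN).subrepresentation FilN hΓN)
        (πbar.toAddMonoidHom.toIntLinearMap.restrict (p := Fil 1) (q := FilN) hπFil).toAddMonoidHom
        continuous_of_discreteTopology
        (fun σ x ↦ Subtype.ext (hbar.equivariant (absGaloisRestrict K (w.adicCompletion K) σ)
          (x : EisensteinLevel p m M 1))) 1 = galoisCohomology.map πP 1 :=
      cohomologyMap_one_eq_map _ _ _ _ _ πP fun _ ↦ rfl
    rw [← heq]
    exact hliftbar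
  -- ### the generic readout
  have key := Tower.map_levelCondition_one_eq_ker (ρ := ρloc) (f := floc)
    (ρG := fun j ↦ (ρloc j).quotient (Fil j) (hΓ j)) (g := q) (q := qI)
    (ρP := fun j ↦ (ρloc j).subrepresentation (Fil j) (hΓ j)) (h := g) (i := sI)
    (ibar := ibar) (qbar := qbar) (πP := πP) (πW := πW) (πG := πG)
    hidG hcompG hinjG hsurjG hexG p hpowG hH0 hqf hi hqi hπi hπq hexbar hliftP hliftbar'
  -- ### translate
  have hcond : κ.eisensteinSelmerStructure ρ t hm S Φ 1 (Sum.inr w) =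
      Tower.levelCondition (H := fun j ↦ galoisCohomology (ρloc j) 1) (fun j ↦ galoisCohomology.map (floc (j + 1) j) 1) p
        (fun j ↦ (galoisCohomology.map (qI j) 1).ker) 1 := by
    have hcores : (fun j ↦ (Φ w hw).ordinaryCore hm j) = fun j ↦ (galoisCohomology.map (qI j) 1).ker := by
      funext j
      change ((ρloc j).quotientMap (Fil j) (hΓ j) 1).ker = _
      rw [hqI j]
    rw [κ.eisensteinSelmerStructure_inr_of_mem ρ t hm S Φ 1 hw, hred, hcores]
    rfl
  rw [IsQuotientBy.propagateStructure_apply, hπW, hcond]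
  refine key.trans ?_
  change (galoisCohomology.map qbar 1).ker = (DiscreteGaloisModule.quotientMap (GaloisRep.toLocal w ρN) FilN hΓN 1).ker
  rw [hqbar]
  rfl

end ZpExtension

end Literature.NumberTheory.EllipticCurves

end
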